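import Mathlib
import Literature.Computability.AlgebraicComplexity.PIProof
import Literature.Computability.AlgebraicComplexity.ArithCircuitProofs
import Literature.Computability.AlgebraicComplexity.ValiantClasses
import Literature.Computability.AlgebraicComplexity.BurgisserTransferProofs

/-!
# Crux `RestorationQP` (stmt-ValiantsHypothesis-10343), line `registered`: stub W1
`stub_vpFamily_piCircuit` — a VP family has polynomial-size Hrubeš–Tzameret circuits

`IsVPFamily f` bounds `deg (f n)` and the fan-in-two straight-line complexity `complexity (f n)`
(Bürgisser 2000, Def. 2.1–2.4: gates are weighted sums `∑ aᵢ • uᵢ` and products `∏ uᵢ` of `≤ 2`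
operands `var x | const c | gate j`, left-fold semantics `gateValues`, junk references read `0`)
by `n ^ c + c`.  Such an `ArithCircuit` is compiled gate by gate into a `PICircuit`
(Hrubeš–Tzameret 2015, §1.1: nodes `var x | const c | add i j | mul i j` over EARLIER positions):
an argument `a • u` costs the nodes `u` (unless an earlier gate), `const a`, `(const a) × u` and
one combining node, so `|toPICircuit P| ≤ 9 |P| + 3` (`size_toPICircuit_le`), and `eval` is
preserved (`eval_toPICircuit`).  Finally `n ^ c + c ≤ (n + 2) ^ (c + 1)`
(`pow_add_le_add_two_pow`).
-/

-- single-problem summit: `Summit.ValiantsHypothesis.ValiantsHypothesis.…` is the namespace by design (D-0017)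
set_option linter.dupNamespace false

noncomputable section

namespace Summit.ValiantsHypothesis.ValiantsHypothesis.Theorems

open MvPolynomial Literature.Computability.AlgebraicComplexity

namespace VpFamilyPiCircuit

open ArithCircuit PICircuit

variable {k : Type*} {σ : Type*} [CommSemiring k]

/-- The value of a node given the values `vals` of the earlier nodes (junk reads `0`). [folklore] -/
def nodeVal (vals : List (MvPolynomial σ k)) : Node k σ → MvPolynomial σ k
  | .var x => X x
  | .const c => C c
  | .add i j => vals.getD i 0 + vals.getD j 0
  | .mul i j => vals.getD i 0 * vals.getD j 0

/-- The values of the nodes of `body`: the polynomials of `unfoldList [] body`. [folklore] -/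
def bodyVals (body : List (Node k σ)) : List (MvPolynomial σ k) :=
  (unfoldList [] body).map PIFormula.eval

/-- The unfolding of a node computes `nodeVal` against the earlier values. [folklore] -/
theorem eval_unfold (U : List (PIFormula k σ)) (n : Node k σ) :
    (n.unfold U).eval = nodeVal (U.map PIFormula.eval) n := by
  have h (i : ℕ) : (U.getD i (.const 0)).eval = (U.map PIFormula.eval).getD i 0 := by
    rw [show (0 : MvPolynomial σ k) = (PIFormula.const (0 : k) : PIFormula k σ).eval by simp,
      List.getD_map]
  cases n with
  | var x | const c => rfl
  | add i j => simp only [Node.unfold, PIFormula.eval_add, nodeVal, h]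
  | mul i j => simp only [Node.unfold, PIFormula.eval_mul, nodeVal, h]

/-- One value per node. [folklore] -/
theorem bodyVals_length (body : List (Node k σ)) : (bodyVals body).length = body.length := by
  simp [bodyVals]

/-- Later nodes do not change the values of earlier nodes. [folklore] -/
theorem getD_bodyVals_of_prefix {body body' : List (Node k σ)} (h : body <+: body') {p : ℕ}
    (hp : p < body.length) : (bodyVals body').getD p 0 = (bodyVals body).getD p 0 := by
  obtain ⟨t, rfl⟩ := h
  obtain ⟨u, hu⟩ := unfoldList_eq_append (unfoldList [] body) t
  have ht : bodyVals (body ++ t) = bodyVals body ++ u.map PIFormula.eval := by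
    simp only [bodyVals, unfoldList_append, hu, List.map_append]
  rw [ht, List.getD_append _ _ _ _ (by rwa [bodyVals_length])]

/-- The value of a freshly appended node. [folklore] -/
theorem getD_bodyVals_append_singleton {body : List (Node k σ)} (n : Node k σ) {p : ℕ}
    (hp : p = body.length) : (bodyVals (body ++ [n])).getD p 0 = nodeVal (bodyVals body) n := by
  have h : bodyVals (body ++ [n]) = bodyVals body ++ [nodeVal (bodyVals body) n] := by
    simp only [bodyVals, unfoldList_append, unfoldList_cons, unfoldList_nil, List.map_append,
      List.map_cons, List.map_nil, eval_unfold]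
  rw [h, List.getD_append_right _ _ _ _ (by rw [bodyVals_length, hp]), bodyVals_length, hp,
    Nat.sub_self]
  simp

/-- Compile an operand after the nodes `body` (gate `j < pos.length` has its value at position
`pos[j]`; a junk gate reference becomes the leaf `0`): new node list, position. [folklore] -/
def compileOperand (pos : List ℕ) (body : List (Node k σ)) : Operand k σ → List (Node k σ) × ℕ
  | .var x => (body ++ [.var x], body.length)
  | .const c => (body ++ [.const c], body.length)
  | .gate j => if j < pos.length then (body, pos.getD j 0) else (body ++ [.const 0], body.length)

/-- One argument `a • u` of a gate (`u` at `q.2` of `q.1`, partial value at `r.2`): append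
`const a`, `(const a) × u`, `bin ((const a) × u) partial`. [folklore] -/
def argStep (bin : ℕ → ℕ → Node k σ) (a : k) (r q : List (Node k σ) × ℕ) : List (Node k σ) × ℕ :=
  (q.1 ++ [.const a] ++ [.mul q.1.length q.2] ++ [bin (q.1.length + 1) r.2], q.1.length + 2)

/-- Compile weighted arguments, combined by `bin` from the leaf `e` (sum / product). [folklore] -/
def compileArgs (bin : ℕ → ℕ → Node k σ) (e : k) (pos : List ℕ) (body : List (Node k σ)) :
    List (k × Operand k σ) → List (Node k σ) × ℕ
  | [] => (body ++ [.const e], body.length)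
  | a :: rest => argStep bin a.1 (compileArgs bin e pos body rest)
      (compileOperand pos (compileArgs bin e pos body rest).1 a.2)

/-- Compile one gate (a product `∏ uᵢ` as `∏ 1 • uᵢ`). [folklore] -/
def compileGate (pos : List ℕ) (body : List (Node k σ)) : Gate k σ → List (Node k σ) × ℕ
  | .sum args => compileArgs .add 0 pos body args
  | .prod args => compileArgs .mul 1 pos body (args.map fun u => ((1 : k), u))

/-- One step of the fold over the gates: compile, record the position of the value. [folklore] -/
def compileStep (s : List ℕ × List (Node k σ)) (g : Gate k σ) : List ℕ × List (Node k σ) :=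
  (s.1 ++ [(compileGate s.1 s.2 g).2], (compileGate s.1 s.2 g).1)

/-- Compile a gate list (left fold, as `gateValues`). [folklore] -/
def compileGates (gs : List (Gate k σ)) (s : List ℕ × List (Node k σ)) :
    List ℕ × List (Node k σ) :=
  gs.foldl compileStep s

/-- The output: append the leaf `0` and output `(value at q.2) + 0`. [folklore] -/
def outStep (q : List (Node k σ) × ℕ) : PICircuit k σ :=
  ⟨q.1 ++ [.const 0], .add q.2 q.1.length⟩

/-- The Hrubeš–Tzameret circuit of a straight-line arithmetic circuit. [folklore] -/
def toPICircuit (P : ArithCircuit k σ) : PICircuit k σ :=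
  outStep (compileOperand (compileGates P.gates ([], [])).1 (compileGates P.gates ([], [])).2
    P.output)

/-- An operand extends the node list by at most one node. [folklore] -/
theorem compileOperand_prefix_length (pos : List ℕ) (body : List (Node k σ)) (u : Operand k σ) :
    body <+: (compileOperand pos body u).1 ∧
      (compileOperand pos body u).1.length ≤ body.length + 1 := by
  cases u with
  | var x | const c => exact ⟨List.prefix_append _ _, by simp [compileOperand]⟩
  | gate j =>
    simp only [compileOperand]
    split
    · exact ⟨List.prefix_rfl, by simp⟩
    · exact ⟨List.prefix_append _ _, by simp⟩

/-- `m` weighted arguments extend the node list by at most `4 m + 1` nodes. [folklore] -/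
theorem compileArgs_prefix_length (bin : ℕ → ℕ → Node k σ) (e : k) (pos : List ℕ)
    (body : List (Node k σ)) : ∀ args : List (k × Operand k σ),
    body <+: (compileArgs bin e pos body args).1 ∧
      (compileArgs bin e pos body args).1.length ≤ body.length + 4 * args.length + 1
  | [] => ⟨List.prefix_append _ _, by simp [compileArgs]⟩
  | a :: rest => by
    obtain ⟨hp, hl⟩ := compileArgs_prefix_length bin e pos body rest
    obtain ⟨hp', hl'⟩ :=
      compileOperand_prefix_length pos (compileArgs bin e pos body rest).1 a.2
    rw [compileArgs]
    simp only [argStep, List.append_assoc, List.length_append, List.length_cons,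
      List.length_nil]
    exact ⟨(hp.trans hp').trans (List.prefix_append _ _), by omega⟩

/-- A gate extends the node list by at most `4 · fanIn + 1` nodes. [folklore] -/
theorem compileGate_prefix_length (pos : List ℕ) (body : List (Node k σ)) (g : Gate k σ) :
    body <+: (compileGate pos body g).1 ∧
      (compileGate pos body g).1.length ≤ body.length + 4 * g.fanIn + 1 := by
  cases g with
  | sum args =>
    simpa only [compileGate, Gate.fanIn, Gate.args, List.length_map] using
      compileArgs_prefix_length Node.add 0 pos body args
  | prod args =>
    simpa only [compileGate, Gate.fanIn, Gate.args, List.length_map] using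
      compileArgs_prefix_length Node.mul 1 pos body (args.map fun u => ((1 : k), u))

/-- A fan-in-two gate list costs at most `9` nodes per gate. [folklore] -/
theorem length_compileGates_le : ∀ (gs : List (Gate k σ)) (s : List ℕ × List (Node k σ)),
    (∀ g ∈ gs, g.fanIn ≤ 2) → (compileGates gs s).2.length ≤ s.2.length + 9 * gs.length
  | [], s, _ => by simp [compileGates]
  | g :: gs, s, h => by
    have hg : g.fanIn ≤ 2 := h g (by simp)
    have ih := length_compileGates_le gs (compileStep s g) fun g' hg' => h g' (by simp [hg'])
    have hs := (compileGate_prefix_length s.1 s.2 g).2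
    have hs' : (compileStep s g).2.length ≤ s.2.length + 9 := by
      change (compileGate s.1 s.2 g).1.length ≤ _
      omega
    change (compileGates gs (compileStep s g)).2.length ≤ _
    simp only [List.length_cons]
    omega

/-- `|toPICircuit P| ≤ 9 |P| + 3` for fan-in-two `P`. [folklore] -/
theorem size_toPICircuit_le {P : ArithCircuit k σ} (h : P.IsFanInTwo) :
    (toPICircuit P).size ≤ 9 * P.size + 3 := by
  have h1 := length_compileGates_le P.gates ([], []) h
  have h2 := (compileOperand_prefix_length (compileGates P.gates ([], [])).1
    (compileGates P.gates ([], [])).2 P.output).2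
  simp only [toPICircuit, outStep, PICircuit.size, List.length_append, List.length_singleton,
    ArithCircuit.size, List.length_nil] at h1 h2 ⊢
  omega

/-- The invariant (`pos[j] < |body|` computes gate `j` of `gs`) survives appending. [folklore] -/
theorem inv_mono {gs : List (Gate k σ)} {pos : List ℕ} {body body' : List (Node k σ)}
    (h : pos.length = gs.length ∧ ∀ j, j < gs.length → pos.getD j 0 < body.length ∧
      (bodyVals body).getD (pos.getD j 0) 0 = (gateValues gs).getD j 0)
    (hb : body <+: body') :
    pos.length = gs.length ∧ ∀ j, j < gs.length → pos.getD j 0 < body'.length ∧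
      (bodyVals body').getD (pos.getD j 0) 0 = (gateValues gs).getD j 0 := by
  refine ⟨h.1, fun j hj => ?_⟩
  obtain ⟨hlt, hval⟩ := h.2 j hj
  exact ⟨hlt.trans_le hb.length_le, by rw [getD_bodyVals_of_prefix hb hlt, hval]⟩

/-- A compiled operand lies in the new node list and computes the operand. [folklore] -/
theorem compileOperand_spec {gs : List (Gate k σ)} {pos : List ℕ} {body : List (Node k σ)}
    (h : pos.length = gs.length ∧ ∀ j, j < gs.length → pos.getD j 0 < body.length ∧
      (bodyVals body).getD (pos.getD j 0) 0 = (gateValues gs).getD j 0) (u : Operand k σ) :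
    (compileOperand pos body u).2 < (compileOperand pos body u).1.length ∧
      (bodyVals (compileOperand pos body u).1).getD (compileOperand pos body u).2 0 =
        u.eval (gateValues gs) := by
  cases u with
  | var x | const c =>
    refine ⟨by simp [compileOperand], ?_⟩
    simp only [compileOperand]
    rw [getD_bodyVals_append_singleton _ rfl]
    rfl
  | gate j =>
    simp only [compileOperand]
    split
    · rename_i hj
      rw [h.1] at hj
      exact h.2 j hj
    · rename_i hj
      refine ⟨by simp, ?_⟩
      have hle : (gateValues gs).length ≤ j := by
        rw [gateValues_length, ← h.1]; exact Nat.le_of_not_lt hj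
      rw [getD_bodyVals_append_singleton _ rfl, Operand.eval_gate, List.getD_eq_default _ _ hle]
      simp [nodeVal]

/-- The argument step computes `bin (a · u) partial` (`bin` has value `binVal`). [folklore] -/
theorem argStep_spec {bin : ℕ → ℕ → Node k σ}
    {binVal : MvPolynomial σ k → MvPolynomial σ k → MvPolynomial σ k}
    (hbin : ∀ vals i j, nodeVal vals (bin i j) = binVal (vals.getD i 0) (vals.getD j 0)) (a : k)
    {r q : List (Node k σ) × ℕ} (hrq : r.1 <+: q.1) (hr : r.2 < r.1.length)
    (hq : q.2 < q.1.length) :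
    (argStep bin a r q).2 < (argStep bin a r q).1.length ∧
      (bodyVals (argStep bin a r q).1).getD (argStep bin a r q).2 0 =
        binVal (C a * (bodyVals q.1).getD q.2 0) ((bodyVals r.1).getD r.2 0) := by
  have h1 : q.1 <+: q.1 ++ [Node.const a] := List.prefix_append _ _
  have h2 : q.1 ++ [Node.const a] <+: q.1 ++ [Node.const a] ++ [Node.mul q.1.length q.2] :=
    List.prefix_append _ _
  refine ⟨by simp [argStep], ?_⟩
  simp only [argStep]
  rw [getD_bodyVals_append_singleton (p := q.1.length + 2) _ (by simp), hbin,
    getD_bodyVals_append_singleton (p := q.1.length + 1) _ (by simp)]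
  simp only [nodeVal]
  rw [getD_bodyVals_append_singleton (p := q.1.length) _ rfl]
  simp only [nodeVal]
  rw [getD_bodyVals_of_prefix h1 hq, getD_bodyVals_of_prefix (hrq.trans (h1.trans h2)) hr]

/-- The compiled arguments compute the `bin`-fold of the `a • u` from the leaf `e`. [folklore] -/
theorem compileArgs_spec {bin : ℕ → ℕ → Node k σ}
    {binVal : MvPolynomial σ k → MvPolynomial σ k → MvPolynomial σ k}
    (hbin : ∀ vals i j, nodeVal vals (bin i j) = binVal (vals.getD i 0) (vals.getD j 0)) (e : k)
    {gs : List (Gate k σ)} {pos : List ℕ} {body : List (Node k σ)}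
    (h : pos.length = gs.length ∧ ∀ j, j < gs.length → pos.getD j 0 < body.length ∧
      (bodyVals body).getD (pos.getD j 0) 0 = (gateValues gs).getD j 0) :
    ∀ args : List (k × Operand k σ),
    (compileArgs bin e pos body args).2 < (compileArgs bin e pos body args).1.length ∧
      (bodyVals (compileArgs bin e pos body args).1).getD (compileArgs bin e pos body args).2 0 =
        args.foldr (fun a acc => binVal (C a.1 * a.2.eval (gateValues gs)) acc) (C e)
  | [] => by
    refine ⟨by simp [compileArgs], ?_⟩
    simp only [compileArgs, List.foldr_nil]
    rw [getD_bodyVals_append_singleton _ rfl]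
    rfl
  | a :: rest => by
    obtain ⟨hr, hrv⟩ := compileArgs_spec hbin e h rest
    obtain ⟨hpre, -⟩ := compileArgs_prefix_length bin e pos body rest
    obtain ⟨hq, hqv⟩ := compileOperand_spec (inv_mono h hpre) a.2
    obtain ⟨hpre', -⟩ :=
      compileOperand_prefix_length pos (compileArgs bin e pos body rest).1 a.2
    have hstep := argStep_spec hbin a.1 hpre' hr hq
    rw [compileArgs]
    refine ⟨hstep.1, ?_⟩
    rw [hstep.2, hqv, hrv, List.foldr_cons]

/-- A weighted sum, folded from the right. [folklore] -/
theorem foldr_eq_eval_sum (vals : List (MvPolynomial σ k)) (args : List (k × Operand k σ)) :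
    args.foldr (fun a acc => C a.1 * a.2.eval vals + acc) (C 0) = (Gate.sum args).eval vals := by
  induction args with
  | nil => simp [Gate.eval]
  | cons a rest ih =>
    rw [List.foldr_cons, ih]
    simp [Gate.eval, smul_eq_C_mul]

/-- A product, folded from the right with unit weights. [folklore] -/
theorem foldr_eq_eval_prod (vals : List (MvPolynomial σ k)) (args : List (Operand k σ)) :
    (args.map fun u => ((1 : k), u)).foldr (fun a acc => C a.1 * a.2.eval vals * acc) (C 1) =
      (Gate.prod args).eval vals := by
  induction args with
  | nil => simp [Gate.eval]
  | cons u rest ih =>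
    rw [List.map_cons, List.foldr_cons, ih]
    simp [Gate.eval]

/-- A compiled gate computes the gate. [folklore] -/
theorem compileGate_spec {gs : List (Gate k σ)} {pos : List ℕ} {body : List (Node k σ)}
    (h : pos.length = gs.length ∧ ∀ j, j < gs.length → pos.getD j 0 < body.length ∧
      (bodyVals body).getD (pos.getD j 0) 0 = (gateValues gs).getD j 0) (g : Gate k σ) :
    (compileGate pos body g).2 < (compileGate pos body g).1.length ∧
      (bodyVals (compileGate pos body g).1).getD (compileGate pos body g).2 0 =
        g.eval (gateValues gs) := by
  cases g with
  | sum args =>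
    obtain ⟨hlt, hval⟩ :=
      compileArgs_spec (bin := Node.add) (binVal := (· + ·)) (fun _ _ _ => rfl) 0 h args
    exact ⟨hlt, hval.trans (foldr_eq_eval_sum _ args)⟩
  | prod args =>
    obtain ⟨hlt, hval⟩ := compileArgs_spec (bin := Node.mul) (binVal := (· * ·))
      (fun _ _ _ => rfl) 1 h (args.map fun u => ((1 : k), u))
    exact ⟨hlt, hval.trans (foldr_eq_eval_prod _ args)⟩

/-- One fold step preserves the invariant (cf. `gateValues_append_singleton`). [folklore] -/
theorem compileStep_spec {gs : List (Gate k σ)} {s : List ℕ × List (Node k σ)}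
    (h : s.1.length = gs.length ∧ ∀ j, j < gs.length → s.1.getD j 0 < s.2.length ∧
      (bodyVals s.2).getD (s.1.getD j 0) 0 = (gateValues gs).getD j 0) (g : Gate k σ) :
    (compileStep s g).1.length = (gs ++ [g]).length ∧ ∀ j, j < (gs ++ [g]).length →
      (compileStep s g).1.getD j 0 < (compileStep s g).2.length ∧
      (bodyVals (compileStep s g).2).getD ((compileStep s g).1.getD j 0) 0 =
        (gateValues (gs ++ [g])).getD j 0 := by
  obtain ⟨hlt, hval⟩ := compileGate_spec h g
  have hpre := (compileGate_prefix_length s.1 s.2 g).1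
  refine ⟨by simp [compileStep, h.1], fun j hj => ?_⟩
  simp only [compileStep]
  rw [List.length_append, List.length_singleton] at hj
  rcases Nat.lt_succ_iff_lt_or_eq.1 hj with hj | rfl
  · obtain ⟨hlt', hval'⟩ := h.2 j hj
    have hj1 : j < s.1.length := by rw [h.1]; exact hj
    have hj2 : j < (gateValues gs).length := by rw [gateValues_length]; exact hj
    rw [List.getD_append _ _ _ _ hj1, gateValues_append_singleton, List.getD_append _ _ _ _ hj2,
      getD_bodyVals_of_prefix hpre hlt', hval']
    exact ⟨hlt'.trans_le hpre.length_le, rfl⟩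
  · simpa [h.1] using And.intro hlt hval

/-- The fold preserves the invariant. [folklore] -/
theorem compileGates_spec : ∀ (gs' gs : List (Gate k σ)) (s : List ℕ × List (Node k σ)),
    (s.1.length = gs.length ∧ ∀ j, j < gs.length → s.1.getD j 0 < s.2.length ∧
      (bodyVals s.2).getD (s.1.getD j 0) 0 = (gateValues gs).getD j 0) →
    (compileGates gs' s).1.length = (gs ++ gs').length ∧ ∀ j, j < (gs ++ gs').length →
      (compileGates gs' s).1.getD j 0 < (compileGates gs' s).2.length ∧
      (bodyVals (compileGates gs' s).2).getD ((compileGates gs' s).1.getD j 0) 0 =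
        (gateValues (gs ++ gs')).getD j 0
  | [], gs, s, h => by rw [List.append_nil]; exact h
  | g :: gs', gs, s, h => by
    have ih := compileGates_spec gs' (gs ++ [g]) (compileStep s g) (compileStep_spec h g)
    rw [List.append_assoc, List.singleton_append] at ih
    exact ih

/-- **The conversion is correct**: `toPICircuit P` computes `P.eval`. [folklore] -/
theorem eval_toPICircuit (P : ArithCircuit k σ) : (toPICircuit P).eval = P.eval := by
  have hinv := compileGates_spec P.gates [] ([], [])
    ⟨rfl, fun j hj => absurd hj (Nat.not_lt_zero j)⟩
  obtain ⟨hq, hqv⟩ := compileOperand_spec hinv P.output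
  rw [toPICircuit, outStep]
  refine (eval_unfold _ _).trans ?_
  change nodeVal (bodyVals (_ ++ [Node.const 0])) _ = _
  simp only [nodeVal]
  rw [getD_bodyVals_of_prefix (List.prefix_append _ _) hq, getD_bodyVals_append_singleton _ rfl,
    hqv]
  simp [nodeVal, ArithCircuit.eval]

/-- Every `f` has a Hrubeš–Tzameret circuit of size `≤ 9 · complexity f + 3`. [folklore] -/
theorem exists_piCircuit_size_le (f : MvPolynomial σ k) :
    ∃ D : PICircuit k σ, D.eval = f ∧ D.size ≤ 9 * complexity f + 3 := by
  obtain ⟨P, h2, hf, hs⟩ := exists_computes_size_eq_complexity f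
  exact ⟨toPICircuit P, (eval_toPICircuit P).trans hf, hs ▸ size_toPICircuit_le h2⟩

end VpFamilyPiCircuit

open VpFamilyPiCircuit in
/-- Stub W1 of crux `RestorationQP` (line `registered`): **a VP family has polynomial-size
Hrubeš–Tzameret circuits** — a minimal fan-in-two `ArithCircuit` for `f n` becomes a `PICircuit`
of size `≤ 9 · complexity (f n) + 3 ≤ (n + 2) ^ (c + 5)` (Bürgisser 2000, Def. 2.1–2.4;
Hrubeš–Tzameret 2015, §1.1). [folklore] -/
theorem stub_vpFamily_piCircuit : ∀ f : (n : ℕ) → MvPolynomial (Fin n × Fin n) ℂ, IsVPFamily f → ∃ c : ℕ, ∀ n : ℕ, (f n).totalDegree ≤ (n + 2) ^ c ∧ ∃ C : PICircuit ℂ (Fin n × Fin n), C.eval = f n ∧ C.size ≤ (n + 2) ^ c := by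
  intro f hf
  obtain ⟨⟨-, c₁, hc₁⟩, c₂, hc₂⟩ := hf
  refine ⟨c₁ + c₂ + 5, fun n => ⟨?_, ?_⟩⟩
  · calc (f n).totalDegree ≤ n ^ c₁ + c₁ := hc₁ n
      _ ≤ (n + 2) ^ (c₁ + 1) := pow_add_le_add_two_pow n c₁
      _ ≤ (n + 2) ^ (c₁ + c₂ + 5) := Nat.pow_le_pow_right (by omega) (by omega)
  · obtain ⟨D, hD, hDs⟩ := exists_piCircuit_size_le (f n)
    refine ⟨D, hD, hDs.trans ?_⟩
    have h1 : complexity (f n) ≤ (n + 2) ^ (c₂ + 1) := (hc₂ n).trans (pow_add_le_add_two_pow n c₂)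
    have h2 : 1 ≤ (n + 2) ^ (c₂ + 1) := Nat.one_le_pow _ _ (by omega)
    have h3 : 2 ^ 4 ≤ (n + 2) ^ 4 := Nat.pow_le_pow_left (by omega) 4
    calc 9 * complexity (f n) + 3 ≤ 12 * (n + 2) ^ (c₂ + 1) := by omega
      _ ≤ (n + 2) ^ 4 * (n + 2) ^ (c₂ + 1) := Nat.mul_le_mul_right _ (by omega)
      _ = (n + 2) ^ (c₂ + 5) := by ring
      _ ≤ (n + 2) ^ (c₁ + c₂ + 5) := Nat.pow_le_pow_right (by omega) (by omega)

end Summit.ValiantsHypothesis.ValiantsHypothesis.Theorems
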